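import Literature.AlgebraicGeometry.Resolution.RsopMonomialIdeals
import Literature.AlgebraicGeometry.Resolution.StrictNormalCrossingsAt
import Literature.AlgebraicGeometry.Resolution.RegularLocalRingsQuotient
import Literature.AlgebraicGeometry.Resolution.AdicCompletionRegular
import HarnessLib

/-!
# `WildQuotients.SummitReduction` (stmt-ResolutionOfSingularities-16324), line `FramePerfect`, stub O3
# (`stub_pair_orbitNormalFormBlowup_chartsOverCentre`): parts of regular systems of parameters —
# toolkit, and the regular case of the chart computation in generic form

Route `ResolutionOfSingularities/WildQuotients`, crux `SummitReduction`; helper file of stub O3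
(de Jong 1996, 4.27 [C2] on the coefficient-free model). At a point of the blow-up of the model,
the local ring of the embedded blow-up chart `L` (regular) carries an explicit part of a regular
system of parameters (`chartsOverCentre_isRsopPart_chartFamily` of the sibling `…Charts` file), and
the local ring of the blown-up model is `O = L/(f)` for the strict transform `f` of the relation.
When `f` is a member of such a part `(f, g, ζ)` — `g` the exceptional generator, `ζ` the other
branches of the total transform of the boundary — everything the stub needs at a REGULAR point
follows generically (`chartsOverCentre_regularCase`): `O` is regular, `ḡ` is a non-zero-divisor,
the boundary is `(ḡ² w)`, its completed radical is `(ḡ w) Ô`, and `(ḡ w)` has local strict normal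
crossings data ("`Z` is given by `ut₁'t₂'t₃ ⋯ t_r = 0`, a normal crossings divisor", de Jong 1996,
p. 76). All PROVED:

* `chartsOverCentre_isRsopPart_of_span_eq`, `chartsOverCentre_isRsopPart_comp_ringEquiv`,
  `chartsOverCentre_isRsopPart_adicCompletion`, `chartsOverCentre_isRsopPart_quotient_cons`,
  `chartsOverCentre_isSNCIdeal_of_isRsopPart` — the toolkit (dependence on the generated ideal
  only; transport along isomorphisms, to the completion, to the quotient by the first member;
  strict normal crossings data from a part);
* `chartsOverCentre_regularCase` — the regular case in generic form.

## Sources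

* A. J. de Jong, *Smoothness, semi-stability and alterations*, Publ. Math. IHÉS 83 (1996), 4.27,
  p. 76. [DeJong1996]
* H. Matsumura, *Commutative Ring Theory* (1986), Thm. 8.11, 14.2, 17.10, 19.5. [Matsumura1987]
* The Stacks Project, Tag 0BI9. [StacksProject]
-/

set_option linter.dupNamespace false -- the tree's summit namespace repeats `ResolutionOfSingularities`

noncomputable section

open IsLocalRing
open Literature.AlgebraicGeometry.Resolution

namespace Summit.ResolutionOfSingularities.ResolutionOfSingularities.Theorems

universe u

/-! ## Toolkit -/

/-- **Being part of a regular system of parameters only depends on the ideal generated** (for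
families of the same length). [folklore] -/
theorem chartsOverCentre_isRsopPart_of_span_eq {R : Type u} [CommRing R] [IsLocalRing R] {n : ℕ}
    {z z' : Fin n → R} (hz : IsRsopPart z) (h : Ideal.span (Set.range z') = Ideal.span (Set.range z)) :
    IsRsopPart z' := by
  obtain ⟨hR, e, y, hdim, hspan⟩ := hz
  exact ⟨hR, e, y, hdim, by rw [Ideal.span_union, h, ← Ideal.span_union, hspan]⟩

/-- **Transport of parts of regular systems of parameters along ring isomorphisms.** [folklore] -/
theorem chartsOverCentre_isRsopPart_comp_ringEquiv {R S : Type u} [CommRing R] [CommRing S]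
    [IsLocalRing R] [IsLocalRing S] {n : ℕ} {z : Fin n → R} (hz : IsRsopPart z) (e : R ≃+* S) :
    IsRsopPart (e ∘ z) := by
  obtain ⟨hR, m, y, hdim, hspan⟩ := hz
  haveI := hR
  refine ⟨IsRegularLocalRing.of_ringEquiv e, m, e ∘ y, ?_, ?_⟩
  · rw [← ringKrullDim_eq_of_ringEquiv e, hdim]
  · have := congrArg (Ideal.map (e : R →+* S)) hspan
    rw [Ideal.map_span, Set.image_union, ← Set.range_comp, ← Set.range_comp, RingHom.coe_coe] at this
    rw [this]
    exact IsLocalRing.eq_maximalIdeal (Ideal.map_isMaximal_of_equiv e (p := maximalIdeal R))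

/-- **Parts of regular systems of parameters pass to the completion** (`𝔪 R̂ = 𝔪̂`,
`dim R̂ = dim R`, `R̂` regular). [cite: Matsumura1987, Thm. 8.11 and proof of Thm. 19.5] -/
theorem chartsOverCentre_isRsopPart_adicCompletion {R : Type u} [CommRing R] [IsLocalRing R]
    [IsNoetherianRing R] {n : ℕ} {z : Fin n → R} (hz : IsRsopPart z) :
    IsRsopPart (algebraMap R (AdicCompletion (maximalIdeal R) R) ∘ z) := by
  obtain ⟨hR, m, y, hdim, hspan⟩ := hz
  haveI := hR
  refine ⟨isRegularLocalRing_adicCompletion R, m, algebraMap R _ ∘ y, ?_, ?_⟩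
  · rw [ringKrullDim_adicCompletion, hdim]
  · rw [AdicCompletion.maximalIdeal_eq_map, ← hspan, Ideal.map_span, Set.image_union,
      ← Set.range_comp, ← Set.range_comp]

/-- **Local strict normal crossings data from a part of a regular system of parameters**: the
product of `n + 1` members (times a unit) generates an ideal with local strict normal crossings
data. [cite: StacksProject, Tag 0BI9] -/
theorem chartsOverCentre_isSNCIdeal_of_isRsopPart {R : Type u} [CommRing R] [IsLocalRing R] {n : ℕ}
    {z : Fin (n + 1) → R} (hz : IsRsopPart z) {u : R} (hu : IsUnit u) :
    IsSNCIdeal (Ideal.span {u * ∏ i, z i}) := by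
  obtain ⟨hR, m, y, hdim, hspan⟩ := hz
  exact ⟨hR, n + 1, m, z, y, Nat.succ_pos n, hdim, hspan, Ideal.span_singleton_mul_left_unit hu _⟩

/-- **The quotient by the first member**: if `(f, ζ₁, …, ζ_n)` is part of a regular system of
parameters of `R`, then the images `(ζ̄₁, …, ζ̄_n)` are part of one of `R/(f)` (`R/(f)` is
regular of dimension `dim R - 1`, and `R/(f, ζ)` is regular of dimension `dim R - 1 - n`).
[cite: Matsumura1987, Thm. 14.2] -/
theorem chartsOverCentre_isRsopPart_quotient_cons {R : Type u} [CommRing R] [IsLocalRing R] {n : ℕ}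
    {f : R} {ζ : Fin n → R} (h : IsRsopPart (Fin.cons f ζ : Fin (n + 1) → R))
    [IsLocalRing (R ⧸ Ideal.span {f})] :
    IsRsopPart (fun i => Ideal.Quotient.mk (Ideal.span {f}) (ζ i)) := by
  haveI := h.isRegularLocalRing
  -- `f` is a member: `R/(f)` regular of dimension `dim R - 1`
  have hf : f ∈ maximalIdeal R := by simpa using h.mem_maximalIdeal 0
  have hf2 : f ∉ maximalIdeal R ^ 2 := by simpa using h.not_mem_sq 0
  obtain ⟨hregf, hdimf⟩ := IsRegularLocalRing.quotient_span_singleton hf hf2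
  haveI := hregf
  -- the double quotient `(R/(f))/(ζ̄) ≅ R/(f, ζ)`
  have hsup : Ideal.span (Set.range (Fin.cons f ζ : Fin (n + 1) → R)) =
      Ideal.span {f} ⊔ Ideal.span (Set.range ζ) := by
    rw [← Ideal.span_union]
    congr 1
    ext x
    simp only [Set.mem_range, Set.singleton_union, Set.mem_insert_iff]
    constructor
    · rintro ⟨i, rfl⟩
      refine Fin.cases (Or.inl rfl) (fun i => Or.inr ⟨i, rfl⟩) i
    · rintro (rfl | ⟨i, rfl⟩)
      · exact ⟨0, rfl⟩
      · exact ⟨i.succ, by simp⟩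
  have hmapζ : (Ideal.span (Set.range ζ)).map (Ideal.Quotient.mk (Ideal.span {f})) =
      Ideal.span (Set.range fun i => Ideal.Quotient.mk (Ideal.span {f}) (ζ i)) := by
    rw [Ideal.map_span, ← Set.range_comp]
    rfl
  let e : (R ⧸ Ideal.span {f}) ⧸ Ideal.span (Set.range fun i => Ideal.Quotient.mk (Ideal.span {f}) (ζ i)) ≃+*
      R ⧸ Ideal.span (Set.range (Fin.cons f ζ : Fin (n + 1) → R)) :=
    (Ideal.quotEquivOfEq hmapζ.symm).trans ((DoubleQuot.quotQuotEquivQuotSup _ _).trans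
      (Ideal.quotEquivOfEq hsup.symm))
  haveI hreg1 := h.isRegularLocalRing_quotient
  haveI hreg2 : IsRegularLocalRing ((R ⧸ Ideal.span {f}) ⧸
      Ideal.span (Set.range fun i => Ideal.Quotient.mk (Ideal.span {f}) (ζ i))) :=
    IsRegularLocalRing.of_ringEquiv e.symm
  haveI : IsLocalHom (Ideal.Quotient.mk (Ideal.span {f})) :=
    IsLocalHom.of_surjective _ Ideal.Quotient.mk_surjective
  refine IsRsopPart.of_isRegularLocalRing_quotient (fun i => ?_) ?_
  · exact map_nonunit (Ideal.Quotient.mk (Ideal.span {f})) _ (h.mem_maximalIdeal i.succ)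
  · -- dimensions: `dim R/(f,ζ) + n = dim R/(f)` from `dim R/(f, ζ) + (n + 1) = dim R = dim R/(f) + 1`
    have h1 := h.ringKrullDim_quotient_add
    rw [ringKrullDim_eq_of_ringEquiv e, ← hdimf] at *
    obtain ⟨N, hN⟩ := ringKrullDim_eq_nat (R ⧸ Ideal.span {f})
    obtain ⟨N', hN'⟩ := ringKrullDim_eq_nat (R ⧸ Ideal.span (Set.range (Fin.cons f ζ : Fin (n + 1) → R)))
    rw [hN, hN'] at h1 ⊢
    have : (N' : WithBot ℕ∞) + ((n + 1 : ℕ) : WithBot ℕ∞) = (N : WithBot ℕ∞) + 1 := h1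
    have h2 : N' + (n + 1) = N + 1 := by exact_mod_cast this
    have h3 : N' + n = N := by omega
    exact le_of_eq (by exact_mod_cast h3)

/-! ## The regular case -/

/-- **The regular case, generically.** Let `(f, g, ζ₁, …, ζ_n)` be part of a regular system of
parameters of the local ring `L` and `J ≡ U g² ∏ ζᵢ (mod f)` with `U` a unit. Then in
`O = L/(f)`: `O` is a regular local ring, `ḡ` is a non-zero-divisor, `(J̄) = (ḡ² w)` with
`w = Ū ∏ ζ̄ᵢ`, `√((J̄) Ô) = (ḡ w) Ô` in the completion, and `(ḡ w) = (ḡ ∏ ζ̄ᵢ)` has local strict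
normal crossings data — the shape "`Z` is given by `u t₁' t₂' t₃ ⋯ t_r = 0`, a normal crossings
divisor" of de Jong 1996, 4.27, with the exceptional divisor `g = 0` counted twice in the total
transform. [cite: DeJong1996, 4.27, p. 76] -/
theorem chartsOverCentre_regularCase {L : Type u} [CommRing L] [IsLocalRing L] {n : ℕ} {f g : L}
    {ζ : Fin n → L} {U J : L} (hrs : IsRsopPart (Fin.cons f (Fin.cons g ζ) : Fin (n + 1 + 1) → L))
    (hU : IsUnit U) (hJ : J - U * g ^ 2 * ∏ i, ζ i ∈ Ideal.span {f})
    [IsLocalRing (L ⧸ Ideal.span {f})] :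
    IsRegularLocalRing (L ⧸ Ideal.span {f}) ∧
    Ideal.Quotient.mk (Ideal.span {f}) g ∈ nonZeroDivisors (L ⧸ Ideal.span {f}) ∧
    Ideal.span {Ideal.Quotient.mk (Ideal.span {f}) J} =
      Ideal.span {Ideal.Quotient.mk (Ideal.span {f}) g ^ 2 *
        Ideal.Quotient.mk (Ideal.span {f}) (U * ∏ i, ζ i)} ∧
    ((Ideal.span {Ideal.Quotient.mk (Ideal.span {f}) J}).map
        (algebraMap (L ⧸ Ideal.span {f}) (AdicCompletion (maximalIdeal (L ⧸ Ideal.span {f}))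
          (L ⧸ Ideal.span {f})))).radical =
      (Ideal.span {Ideal.Quotient.mk (Ideal.span {f}) g *
        Ideal.Quotient.mk (Ideal.span {f}) (U * ∏ i, ζ i)}).map
        (algebraMap (L ⧸ Ideal.span {f}) (AdicCompletion (maximalIdeal (L ⧸ Ideal.span {f}))
          (L ⧸ Ideal.span {f}))) ∧
    IsSNCIdeal (Ideal.span {Ideal.Quotient.mk (Ideal.span {f}) g *
      Ideal.Quotient.mk (Ideal.span {f}) (U * ∏ i, ζ i)}) := by
  have hq := chartsOverCentre_isRsopPart_quotient_cons hrs
  haveI := hq.isRegularLocalRing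
  haveI : IsDomain (L ⧸ Ideal.span {f}) := isDomain_of_isRegularLocalRing _
  set π := Ideal.Quotient.mk (Ideal.span {f}) with hπ
  -- the family `(ḡ, ζ̄)` and its products
  have hcons : (fun i => π ((Fin.cons g ζ : Fin (n + 1) → L) i)) =
      (Fin.cons (π g) (fun i => π (ζ i)) : Fin (n + 1) → L ⧸ Ideal.span {f}) := by
    funext i
    refine Fin.cases ?_ (fun i => ?_) i <;> simp
  rw [hcons] at hq
  have hprod : ∏ i, (Fin.cons (π g) (fun i => π (ζ i)) : Fin (n + 1) → L ⧸ Ideal.span {f}) i =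
      π g * π (∏ i, ζ i) := by
    rw [Fin.prod_univ_succ, Fin.cons_zero, map_prod]
    simp only [Fin.cons_succ]
  have hJ' : π J = π U * π g ^ 2 * π (∏ i, ζ i) := by
    have : π J = π (U * g ^ 2 * ∏ i, ζ i) := (Ideal.Quotient.mk_eq_mk_iff_sub_mem _ _).mpr hJ
    rw [this, map_mul, map_mul, map_pow]
  have hπU : IsUnit (π U) := hU.map π
  refine ⟨hq.isRegularLocalRing, ?_, ?_, ?_, ?_⟩
  · exact mem_nonZeroDivisors_of_ne_zero (by simpa using hq.ne_zero 0)
  · rw [hJ', map_mul, show π U * π g ^ 2 * π (∏ i, ζ i) = π U * (π g ^ 2 * (π U * π (∏ i, ζ i))) *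
      ↑(hπU.unit⁻¹) by
        rw [mul_comm _ (↑(hπU.unit⁻¹) : L ⧸ Ideal.span {f})]
        simp only [← mul_assoc, IsUnit.val_inv_mul, one_mul]
        ring]
    rw [Ideal.span_singleton_mul_right_unit (Units.isUnit _), Ideal.span_singleton_mul_left_unit hπU]
  · -- radicals in the completion
    have hĉ := chartsOverCentre_isRsopPart_adicCompletion hq
    set of := algebraMap (L ⧸ Ideal.span {f}) (AdicCompletion (maximalIdeal (L ⧸ Ideal.span {f}))
      (L ⧸ Ideal.span {f})) with hof
    have hprod' : ∏ i, (of ∘ (Fin.cons (π g) (fun i => π (ζ i)) : Fin (n + 1) → L ⧸ Ideal.span {f})) i =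
        of (π g) * of (π (∏ i, ζ i)) := by
      rw [← map_mul, ← hprod, map_prod]
      rfl
    have hpow : ∏ i, (of ∘ (Fin.cons (π g) (fun i => π (ζ i)) : Fin (n + 1) → L ⧸ Ideal.span {f})) i ^
        (Fin.cons 2 (fun _ => 1) : Fin (n + 1) → ℕ) i = of (π g) ^ 2 * of (π (∏ i, ζ i)) := by
      rw [Fin.prod_univ_succ]
      simp only [Function.comp_apply, Fin.cons_zero, Fin.cons_succ, pow_one, map_prod]
    have h1 : (Ideal.span {π J}).map of = Ideal.span {of (π U) * ∏ i,
        (of ∘ (Fin.cons (π g) (fun i => π (ζ i)) : Fin (n + 1) → L ⧸ Ideal.span {f})) i ^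
          (Fin.cons 2 (fun _ => 1) : Fin (n + 1) → ℕ) i} := by
      rw [Ideal.map_span, Set.image_singleton, hJ', hpow, map_mul, map_mul, map_pow, mul_assoc]
    have h2 : (Ideal.span {π g * π (U * ∏ i, ζ i)}).map of = Ideal.span {∏ i,
        (of ∘ (Fin.cons (π g) (fun i => π (ζ i)) : Fin (n + 1) → L ⧸ Ideal.span {f})) i} := by
      rw [Ideal.map_span, Set.image_singleton, hprod', map_mul π U, map_mul of (π g), map_mul of (π U),
        show of (π g) * (of (π U) * of (π (∏ i, ζ i))) = of (π U) * (of (π g) * of (π (∏ i, ζ i))) by ring]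
      exact Ideal.span_singleton_mul_left_unit (hπU.map of) _
    rw [h1, h2]
    exact hĉ.radical_span_unit_mul_prod_pow (hπU.map of) _ (fun i => Fin.cases (by simp) (fun _ => by simp) i)
  · rw [map_mul π U, show π g * (π U * π (∏ i, ζ i)) = π U * (π g * π (∏ i, ζ i)) by ring, ← hprod]
    exact chartsOverCentre_isSNCIdeal_of_isRsopPart hq hπU

end Summit.ResolutionOfSingularities.ResolutionOfSingularities.Theorems

end
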